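import Summits.BirchSwinnertonDyer.BirchSwinnertonDyer.Theorems.SignedLowerHalvesSprungLowerHalfAtThreeKDotSplitReal
import Literature.NumberTheory.EllipticCurves.CyclotomicZpExtensionLocalGeneratorProofs
import Summits.BirchSwinnertonDyer.Rank1Residual.Supersingular.SharpFlatNonvanishing
import Literature.NumberTheory.EllipticCurves.Sprung2012.SharpFlatKatoDivisibility
import HarnessLib

/-!
# Route `SignedLowerHalves`, crux `SprungLowerHalfAtThree` (item stmt-BirchSwinnertonDyer-19003), stub (B)
# `stub_chromaticDivisibility`: the local lift `hlift` of `…KDotSplitReal.lean` DISCHARGED — stub (B)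
# VERBATIM on X8 ∩ {N square-free} from (conv₀) ∧ (MC↓•) and NAMED PRINT only
# (cell `bsd-ssimc`, seat `bsd-ssimc-k3c5-kdot-split` g3; a `--supports … --as helper` file, closes nothing)

PARTITION (cell bsd-ssimc): X8 (A8) — `p = 3` good supersingular, `a_3 = ±3` — ∩ {`N` square-free},
crux 5's clause (B); proves-displayed-inputs-of; closes NONE; nothing is booked; BSD is not proved
by any of this.

## What this file proves

The predecessor `…KDotSplitReal.lean` (p470332) proved the registered stub (B) verbatim (with
`W.IsSemistable (𝓞 ℚ)` inserted) from the named facts `h22` (Sprung 2012 Thm. 2.2), `h52`, `hK`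
(Sprung 2024 §5.2), the OPEN inputs `hconv` = (conv₀) / `hdiv` = (MC↓•), and ONE displayed folklore
binder

  `hlift : ∀ p κ γ, κ.IsCyclotomic → κ.IsTopGenerator γ → ∀ v ∋ p, ∃ g ∈ Γ_{ℚ_v}, κ.IsTopGenerator (res g)`

("a local Galois element at `p` restricting to the chosen topological generator; `p` is totally
ramified in `ℚ_∞`; not yet a tree lemma"). It now IS a tree lemma:
`Literature.…ZpExtension.IsCyclotomic.exists_isTopGenerator_resGalOfEmb_adicCompletion` (p473737,
`CyclotomicZpExtensionLocalGeneratorProofs.lean`: `κ ∘ res_{ℚ_v}` is onto, from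
`χ_p(I_{ℚ_v}) = ℤ_pˣ` — Serre, *Local Fields* IV §4 Prop. 17 — `χ_p ∘ res = χ_p` and `ker χ_p ≤ ker κ`).
Hence:

* `sprungLocalLift_holds` — the binder `hlift` of p470332, AS A THEOREM (its type verbatim);
* `stub_chromaticDivisibility_semistable_of_sharpFlatLowerDivisibility` — the registered stub (B)
  header VERBATIM + `W.IsSemistable (𝓞 ℚ)`, from (conv₀) ∧ (MC↓•) and the named facts `h22`, `h52`,
  `hK` ONLY (= p470332's `…_of_sharpFlatLowerDivisibility_semistable` with `hlift` discharged);
* `stub_chromaticDivisibility_semistable_rankZero_of_sharpFlatLowerDivisibility` — the same on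
  `{r_an = 0}` with (conv₀) replaced by modularity `hasEntireLFunction_rat` by name (= p470332's
  `…_rankZero` with `hlift` discharged).

So, for the planner's glued split of crux 5 (D23-8 (a): children (conv₀) · ChromaticLowerDivisibility
(= `hdiv` verbatim) · "the local lift unless it is proved first"): the third child is PROVED; on
X8 ∩ {square-free `N`} clause (B) ⟸ (conv₀) ∧ (MC↓•) with every other input a NAMED PUBLISHED FACT
(`Sprung2012.thm22_exists_isHondaSystem`, `Sprung2024.sec52_…`, `Sprung2024.lem59_…`, and on the
rank-`0` variant `hasEntireLFunction_rat`). HONEST STATUS: CONDITIONAL theorems (named-fact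
hypotheses; displayed OPEN `hconv`, `hdiv`); (MC↓•) is Sprung 2012 Main Conj. 7.21's Eisenstein half
for one colour on the REAL `X^•(E/ℚ_∞)` — open mathematics; 0 cells move; BSD is not proved.

References: [Sprung2012] Thm. 2.2, Def. 7.11, Main Conj. 7.21; [Sprung2024] §5.2 Lemmas 5.5–5.9;
[SerreLocalFields1979] Ch. IV §4 Prop. 17; [Washington1997] §13.1; [Kobayashi2003] §2 p. 4.
-/

set_option autoImplicit false
-- justification: the mandated namespace `Summit.BirchSwinnertonDyer.BirchSwinnertonDyer.Theorems`
-- (single-conjunct summit, Sub = Summit) repeats a segment by design (D-0017).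
set_option linter.dupNamespace false

noncomputable section

open scoped Classical MatrixGroups ModularForm NumberField

open CongruenceSubgroup WeierstrassCurve NumberField IsDedekindDomain
  Literature.NumberTheory.EllipticCurves Literature.NumberTheory.EllipticCurves.ModularForms
  Literature.NumberTheory.EllipticCurves.Rank1Residual
  Literature.NumberTheory.EllipticCurves.Rank1Residual.Typed
  Literature.NumberTheory.EllipticCurves.Sprung2017 Literature.NumberTheory.EllipticCurves.Sprung2012
  Literature.NumberTheory.EllipticCurves.ZpExtension
  Summit.BirchSwinnertonDyer.Rank1Residual.Supersingular

namespace Summit.BirchSwinnertonDyer.BirchSwinnertonDyer.Theorems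

section Lift

/-- **The local lift `hlift` of p470332 is a THEOREM** (its binder type verbatim): for every prime
`p`, every cyclotomic `ℤ_p`-extension `κ` of `ℚ` (with any topological generator `γ`) and the place
`v ∋ p` of `ℚ`, some `g ∈ Γ_{ℚ_v}` restricts to a normalised topological generator,
`κ(res g) = 1`. Immediate from
`ZpExtension.IsCyclotomic.exists_isTopGenerator_resGalOfEmb_adicCompletion` (the decomposition
group at `p` surjects onto `Gal(ℚ_∞/ℚ)`: `ℚ(μ_{p^∞})/ℚ` is totally ramified at `p`).
[cite: SerreLocalFields1979, Ch. IV §4 Prop. 17] [cite: Kobayashi2003, §2 p. 4] -/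
theorem sprungLocalLift_holds :
    ∀ (p : ℕ) [Fact p.Prime] (κ : ZpExtension ℚ p) (γ : Field.absoluteGaloisGroup ℚ),
      κ.IsCyclotomic → κ.IsTopGenerator γ →
      ∀ (v : HeightOneSpectrum (𝓞 ℚ)), (p : 𝓞 ℚ) ∈ v.asIdeal →
        ∃ g : Field.absoluteGaloisGroup (v.adicCompletion ℚ),
          κ.IsTopGenerator (resGalOfEmb (closureEmb (K := ℚ) (v.adicCompletion ℚ)) g) :=
  fun _ _ _ _ hκ _ v hv => hκ.exists_isTopGenerator_resGalOfEmb_adicCompletion v hv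

end Lift

section Real

/-- **The registered stub (B) VERBATIM on X8 ∩ {`N` square-free}, from (conv₀) ∧ (MC↓•) on Sprung's
REAL `X^•(E/ℚ_∞)` and NAMED PRINT only** — p470332's
`stub_chromaticDivisibility_of_sharpFlatLowerDivisibility_semistable` with the folklore binder
`hlift` DISCHARGED (`sprungLocalLift_holds`). Inputs BY NAME: `h22` (Sprung 2012 Thm. 2.2: Honda
systems exist), `h52` (Sprung 2024 §5.2 / Sprung 2012 Thm. 7.14: cotorsion at `L(E,1) ≠ 0`), `hK`
((K•) = Sprung 2024 Lemmas 5.5·5.8·5.9). Displayed OPEN inputs: `hconv` = (conv₀) on X8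
(`Finite Sel_{p^∞}(E/ℚ) → L(E,1) ≠ 0`); `hdiv` = (MC↓•): Sprung 2012 Main Conj. 7.21's Eisenstein half,
Néron-normalised, for ONE colour, on the real `SharpFlatSelmerDualData` (the planner's
`ChromaticLowerDivisibility`). Conclusion: the header of `stub_chromaticDivisibility`
(`Cruxes/SprungLowerHalfAtThree/Lines/birth.lean`) with `W.IsSemistable (𝓞 ℚ)` inserted (the printed
scope of (K•): 28 of the 142 rank-`0` A8 cells verbatim; all positive-rank cells). CONDITIONAL;
closes nothing; 0 cells move.
[cite: Sprung2012, Def. 7.11 and Main Conj. 7.21 (shape of `hdiv`)] [cite: Sprung2024, §5.2 Lemmas 5.5–5.9 (via `hK`)] -/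
theorem stub_chromaticDivisibility_semistable_of_sharpFlatLowerDivisibility
    (h22 : Sprung2012.thm22_exists_isHondaSystem)
    (h52 : Sprung2024.sec52_sharpFlatSelmerDual_finite_torsion)
    (hK : Sprung2024.lem59_sharpFlatCharValue_rankZero)
    (hconv : ∀ (W : WeierstrassCurve ℚ) [W.IsElliptic] [W.IsGloballyMinimal] (p : ℕ) [Fact p.Prime],
      ClassX8 W p → Finite (W.selmerGroupPInfty p) → W.entireLFunction 1 ≠ 0)
    (hdiv : ∀ (W : WeierstrassCurve ℚ) [W.IsElliptic] [W.IsGloballyMinimal] (p : ℕ) [Fact p.Prime],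
      ClassX8 W p → ∀ (κ : ZpExtension ℚ p) (γ : Field.absoluteGaloisGroup ℚ),
        κ.IsCyclotomic → κ.IsTopGenerator γ → IsCyclotomicVariable p γ →
      ∀ (v : HeightOneSpectrum (𝓞 ℚ)), (p : 𝓞 ℚ) ∈ v.asIdeal →
      ∀ (g : Field.absoluteGaloisGroup (v.adicCompletion ℚ)),
        κ.IsTopGenerator (resGalOfEmb (closureEmb (K := ℚ) (v.adicCompletion ℚ)) g) →
      ∀ (cneg : localPoints W (v.adicCompletion ℚ)) (c : ℕ → localPoints W (v.adicCompletion ℚ)),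
        IsHondaSystem κ (closureEmb (K := ℚ) (v.adicCompletion ℚ)) W (W.frobeniusTrace p) g cneg c →
      ∀ (N : ℕ) (_ : NeZero N) (f : CuspForm (Gamma0 N) 2) (ϖ : ℚ) (Lsharp Lflat : IwasawaAlgebra p),
        IsNewformOf W f → (ϖ : ℝ) * W.realPeriodRat = plusPeriod f →
        IsSprungPair f p (W.frobeniusTrace p) Lsharp Lflat →
        ∃ col : Chroma,
          ∀ D : SharpFlatSelmerDualData W κ γ (closureEmb (K := ℚ) (v.adicCompletion ℚ))
            (W.frobeniusTrace p) g c col,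
          ∃ gen h : IwasawaAlgebra p, D.charIdeal = Ideal.span {gen} ∧
            iwasawaToPowerSeries p gen =
              PowerSeries.C (ϖ : ℚ_[p]) * iwasawaToPowerSeries p (chromaticL col Lsharp Lflat * h)) :
    ∀ (W : WeierstrassCurve ℚ) [W.IsElliptic] [W.IsGloballyMinimal] (p : ℕ) [Fact p.Prime],
      Literature.NumberTheory.EllipticCurves.Rank1Residual.ClassX8 W p → W.IsSemistable (𝓞 ℚ) →
      ∀ (N : ℕ) (_ : NeZero N) (f : CuspForm (CongruenceSubgroup.Gamma0 N) 2) (ϖ : ℚ)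
        (Lsharp Lflat : Literature.NumberTheory.EllipticCurves.IwasawaAlgebra p),
        Literature.NumberTheory.EllipticCurves.ModularForms.IsNewformOf W f →
        (ϖ : ℝ) * W.realPeriodRat = Literature.NumberTheory.EllipticCurves.ModularForms.plusPeriod f →
        Literature.NumberTheory.EllipticCurves.Sprung2017.IsSprungPair f p (W.frobeniusTrace p)
          Lsharp Lflat →
        ∃ (c : Literature.NumberTheory.EllipticCurves.Sprung2017.Chroma)
          (ξ : Literature.NumberTheory.EllipticCurves.IwasawaAlgebra p),
          (⟨ξ, 0, 0⟩ : Summit.BirchSwinnertonDyer.Rank1Residual.Supersingular.SignedDatum W p).EulerCharacteristic ∧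
          ∃ h : Literature.NumberTheory.EllipticCurves.IwasawaAlgebra p,
            Literature.NumberTheory.EllipticCurves.iwasawaToPowerSeries p ξ =
              PowerSeries.C (ϖ : ℚ_[p]) *
                Literature.NumberTheory.EllipticCurves.iwasawaToPowerSeries p
                  (Literature.NumberTheory.EllipticCurves.Sprung2017.chromaticL c Lsharp Lflat * h) :=
  stub_chromaticDivisibility_of_sharpFlatLowerDivisibility_semistable h22 h52 hK
    sprungLocalLift_holds hconv hdiv

/-- **The registered stub (B) VERBATIM on X8 ∩ {`N` square-free} ∩ {`r_an = 0`}, from (MC↓•) on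
Sprung's REAL `X^•(E/ℚ_∞)` and NAMED PRINT only** — p470332's
`stub_chromaticDivisibility_of_sharpFlatLowerDivisibility_rankZero` with `hlift` DISCHARGED
(`sprungLocalLift_holds`): at analytic rank `0` the (conv₀) input is replaced by modularity
`hmod : hasEntireLFunction_rat` (`r_an = 0 ⇒ L(E,1) ≠ 0`). Together with p455213's
`stub_chromaticDivisibility_of_analyticRank_eq_one` (r_an `= 1`, GZK) this covers X8 ∩ {square-free}
∩ {r_an ≤ 1}: clause (B) there reads «Sprung's Main Conj. 7.21 Eisenstein half for one colour» BY
NAME, every other input named print. CONDITIONAL; closes nothing; 0 cells move.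
[cite: Sprung2012, Def. 7.11 and Main Conj. 7.21 (shape of `hdiv`)] [cite: Sprung2024, §5.2 Lemmas 5.5–5.9 (via `hK`)] -/
theorem stub_chromaticDivisibility_semistable_rankZero_of_sharpFlatLowerDivisibility
    (h22 : Sprung2012.thm22_exists_isHondaSystem)
    (h52 : Sprung2024.sec52_sharpFlatSelmerDual_finite_torsion)
    (hK : Sprung2024.lem59_sharpFlatCharValue_rankZero) (hmod : hasEntireLFunction_rat)
    (hdiv : ∀ (W : WeierstrassCurve ℚ) [W.IsElliptic] [W.IsGloballyMinimal] (p : ℕ) [Fact p.Prime],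
      ClassX8 W p → ∀ (κ : ZpExtension ℚ p) (γ : Field.absoluteGaloisGroup ℚ),
        κ.IsCyclotomic → κ.IsTopGenerator γ → IsCyclotomicVariable p γ →
      ∀ (v : HeightOneSpectrum (𝓞 ℚ)), (p : 𝓞 ℚ) ∈ v.asIdeal →
      ∀ (g : Field.absoluteGaloisGroup (v.adicCompletion ℚ)),
        κ.IsTopGenerator (resGalOfEmb (closureEmb (K := ℚ) (v.adicCompletion ℚ)) g) →
      ∀ (cneg : localPoints W (v.adicCompletion ℚ)) (c : ℕ → localPoints W (v.adicCompletion ℚ)),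
        IsHondaSystem κ (closureEmb (K := ℚ) (v.adicCompletion ℚ)) W (W.frobeniusTrace p) g cneg c →
      ∀ (N : ℕ) (_ : NeZero N) (f : CuspForm (Gamma0 N) 2) (ϖ : ℚ) (Lsharp Lflat : IwasawaAlgebra p),
        IsNewformOf W f → (ϖ : ℝ) * W.realPeriodRat = plusPeriod f →
        IsSprungPair f p (W.frobeniusTrace p) Lsharp Lflat →
        ∃ col : Chroma,
          ∀ D : SharpFlatSelmerDualData W κ γ (closureEmb (K := ℚ) (v.adicCompletion ℚ))
            (W.frobeniusTrace p) g c col,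
          ∃ gen h : IwasawaAlgebra p, D.charIdeal = Ideal.span {gen} ∧
            iwasawaToPowerSeries p gen =
              PowerSeries.C (ϖ : ℚ_[p]) * iwasawaToPowerSeries p (chromaticL col Lsharp Lflat * h)) :
    ∀ (W : WeierstrassCurve ℚ) [W.IsElliptic] [W.IsGloballyMinimal] (p : ℕ) [Fact p.Prime],
      Literature.NumberTheory.EllipticCurves.Rank1Residual.ClassX8 W p → W.IsSemistable (𝓞 ℚ) →
      W.analyticRank = 0 →
      ∀ (N : ℕ) (_ : NeZero N) (f : CuspForm (CongruenceSubgroup.Gamma0 N) 2) (ϖ : ℚ)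
        (Lsharp Lflat : Literature.NumberTheory.EllipticCurves.IwasawaAlgebra p),
        Literature.NumberTheory.EllipticCurves.ModularForms.IsNewformOf W f →
        (ϖ : ℝ) * W.realPeriodRat = Literature.NumberTheory.EllipticCurves.ModularForms.plusPeriod f →
        Literature.NumberTheory.EllipticCurves.Sprung2017.IsSprungPair f p (W.frobeniusTrace p)
          Lsharp Lflat →
        ∃ (c : Literature.NumberTheory.EllipticCurves.Sprung2017.Chroma)
          (ξ : Literature.NumberTheory.EllipticCurves.IwasawaAlgebra p),
          (⟨ξ, 0, 0⟩ : Summit.BirchSwinnertonDyer.Rank1Residual.Supersingular.SignedDatum W p).EulerCharacteristic ∧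
          ∃ h : Literature.NumberTheory.EllipticCurves.IwasawaAlgebra p,
            Literature.NumberTheory.EllipticCurves.iwasawaToPowerSeries p ξ =
              PowerSeries.C (ϖ : ℚ_[p]) *
                Literature.NumberTheory.EllipticCurves.iwasawaToPowerSeries p
                  (Literature.NumberTheory.EllipticCurves.Sprung2017.chromaticL c Lsharp Lflat * h) :=
  stub_chromaticDivisibility_of_sharpFlatLowerDivisibility_rankZero h22 h52 hK hmod
    sprungLocalLift_holds hdiv

end Real

/-! ## §2 (appended, same seat): cotorsion from its PRIMARY source — Sprung 2012 Thm. 1.2 / 7.14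
(`Sprung2012.thm714_sharpFlatSelmerDual_finite_torsion`, typed by the literature layer, p471329)
replaces the Sprung 2024 §5.2 citation `Sprung2024.sec52_…` (`h52`): at `L(E,1) ≠ 0` BOTH colours
of the Sprung pair are non-zero (Prop. 6.14, tree theorem
`sharp_ne_zero_and_flat_ne_zero_of_entireLFunction_one_ne_zero`), so Thm. 7.14 applies to the
colour delivered by (MC↓•). -/

section Primary

/-- The place of `ℚ` above a rational prime (going up along `ℤ → 𝓞 ℚ`). [folklore] -/
private theorem exists_heightOneSpectrum_natCast_mem_rat' (p : ℕ) (hp : p.Prime) :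
    ∃ v : HeightOneSpectrum (𝓞 ℚ), (p : 𝓞 ℚ) ∈ v.asIdeal := by
  haveI hmax : (Ideal.span {(p : ℤ)}).IsMaximal :=
    PrincipalIdealRing.isMaximal_of_irreducible (Nat.prime_iff_prime_int.mp hp).irreducible
  obtain ⟨Q, hQmax, hQ⟩ := Ideal.exists_ideal_over_maximal_of_isIntegral (S := 𝓞 ℚ)
    (Ideal.span {(p : ℤ)}) (by
      rw [(RingHom.injective_iff_ker_eq_bot _).mp (algebraMap ℤ (𝓞 ℚ)).injective_int]
      exact bot_le)
  have hpQ : (p : 𝓞 ℚ) ∈ Q := by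
    have : (p : ℤ) ∈ Q.comap (algebraMap ℤ (𝓞 ℚ)) := by
      rw [hQ]; exact Ideal.mem_span_singleton_self _
    simpa [Ideal.mem_comap] using this
  have hQne : Q ≠ ⊥ := by
    intro hbot
    rw [hbot, Ideal.mem_bot] at hpQ
    exact hp.ne_zero (by exact_mod_cast hpQ)
  exact ⟨⟨Q, hQmax.isPrime, hQne⟩, hpQ⟩

/-- **(B) for one X8 pair with square-free conductor — cotorsion from Sprung 2012 Thm. 1.2 / 7.14
(`h714`, PRIMARY source) instead of Sprung 2024 §5.2 (`h52`), local lift PROVED.** Inputs BY NAME: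
`h22` (Sprung 2012 Thm. 2.2), `h714` (Sprung 2012 Thm. 1.2 = 7.14 at `η = 1`: `X^•` finitely generated
torsion when `L^• ≠ 0`), `hK` ((K•) = Sprung 2024 Lemmas 5.5·5.8·5.9). Displayed OPEN: `hdiv` = (MC↓•),
and for THIS pair `hconv : Finite Sel_{p^∞}(E/ℚ) → L(E,1) ≠ 0`. New step: at `L(E,1) ≠ 0` both `L♯`,
`L♭ ≠ 0` (Sprung 2012 Prop. 6.14, tree theorem), so `h714` applies to the colour of (MC↓•).
CONDITIONAL; closes nothing. [cite: Sprung2012, Thm. 1.2 (p. 1486), Prop. 6.14 (p. 1498), Main Conj. 7.21]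
[cite: Sprung2024, §5.2 Lemmas 5.5–5.9 (via `hK`)] -/
theorem chromaticDivisibility_of_sharpFlatLowerDivisibility_of_thm714
    (h22 : Sprung2012.thm22_exists_isHondaSystem)
    (h714 : Sprung2012.thm714_sharpFlatSelmerDual_finite_torsion)
    (hK : Sprung2024.lem59_sharpFlatCharValue_rankZero)
    (hdiv : ∀ (W : WeierstrassCurve ℚ) [W.IsElliptic] [W.IsGloballyMinimal] (p : ℕ) [Fact p.Prime],
      ClassX8 W p → ∀ (κ : ZpExtension ℚ p) (γ : Field.absoluteGaloisGroup ℚ),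
        κ.IsCyclotomic → κ.IsTopGenerator γ → IsCyclotomicVariable p γ →
      ∀ (v : HeightOneSpectrum (𝓞 ℚ)), (p : 𝓞 ℚ) ∈ v.asIdeal →
      ∀ (g : Field.absoluteGaloisGroup (v.adicCompletion ℚ)),
        κ.IsTopGenerator (resGalOfEmb (closureEmb (K := ℚ) (v.adicCompletion ℚ)) g) →
      ∀ (cneg : localPoints W (v.adicCompletion ℚ)) (c : ℕ → localPoints W (v.adicCompletion ℚ)),
        IsHondaSystem κ (closureEmb (K := ℚ) (v.adicCompletion ℚ)) W (W.frobeniusTrace p) g cneg c →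
      ∀ (N : ℕ) (_ : NeZero N) (f : CuspForm (Gamma0 N) 2) (ϖ : ℚ) (Lsharp Lflat : IwasawaAlgebra p),
        IsNewformOf W f → (ϖ : ℝ) * W.realPeriodRat = plusPeriod f →
        IsSprungPair f p (W.frobeniusTrace p) Lsharp Lflat →
        ∃ col : Chroma,
          ∀ D : SharpFlatSelmerDualData W κ γ (closureEmb (K := ℚ) (v.adicCompletion ℚ))
            (W.frobeniusTrace p) g c col,
          ∃ gen h : IwasawaAlgebra p, D.charIdeal = Ideal.span {gen} ∧
            iwasawaToPowerSeries p gen =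
              PowerSeries.C (ϖ : ℚ_[p]) * iwasawaToPowerSeries p (chromaticL col Lsharp Lflat * h))
    (W : WeierstrassCurve ℚ) [W.IsElliptic] [W.IsGloballyMinimal] (p : ℕ) [Fact p.Prime]
    (hX : ClassX8 W p) (hsst : W.IsSemistable (𝓞 ℚ))
    (hconv : Finite (W.selmerGroupPInfty p) → W.entireLFunction 1 ≠ 0)
    (N : ℕ) (hN : NeZero N) (f : CuspForm (Gamma0 N) 2) (ϖ : ℚ) (Lsharp Lflat : IwasawaAlgebra p)
    (hf : IsNewformOf W f) (hϖ : (ϖ : ℝ) * W.realPeriodRat = plusPeriod f)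
    (hSP : IsSprungPair f p (W.frobeniusTrace p) Lsharp Lflat) :
    ∃ (col : Chroma) (ξ : IwasawaAlgebra p), (⟨ξ, 0, 0⟩ : SignedDatum W p).EulerCharacteristic ∧
      ∃ h : IwasawaAlgebra p, iwasawaToPowerSeries p ξ =
        PowerSeries.C (ϖ : ℚ_[p]) * iwasawaToPowerSeries p (chromaticL col Lsharp Lflat * h) := by
  by_cases hfin : Finite (W.selmerGroupPInfty p)
  swap
  · exact ⟨.flat, chromaticDatum_of_not_finite_selmer W p hfin ϖ (chromaticL .flat Lsharp Lflat)⟩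
  have hp3 : p = 3 := hX.1
  subst hp3
  have hp2 : (3 : ℕ) ≠ 2 := by decide
  have hgood : W.HasGoodReductionAtPrime 3 := hX.2.1.1
  have hdvd : ((3 : ℕ) : ℤ) ∣ W.frobeniusTrace 3 := hX.2.1.2
  have hL : W.entireLFunction 1 ≠ 0 := hconv hfin
  haveI : NeZero N := hN
  -- the cyclotomic setting, the place above `3`, a local lift (PROVED: p473737), a Honda system
  obtain ⟨κ, hκ, γ, hγ, hγ'⟩ := exists_isCyclotomic_isTopGenerator_isCyclotomicVariable_holds 3
  obtain ⟨v, hv⟩ := exists_heightOneSpectrum_natCast_mem_rat' 3 (by norm_num)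
  obtain ⟨g, hg⟩ := hκ.exists_isTopGenerator_resGalOfEmb_adicCompletion v hv
  obtain ⟨cneg, c, hc⟩ := h22 W 3 hp2 hgood hdvd κ γ hκ hγ hγ' v hv g hg
  -- (MC↓•): a colour, and for every dual datum a generator with the Néron-normalised divisibility
  obtain ⟨col, hcol⟩ := hdiv W 3 hX κ γ hκ hγ hγ' v hv g hg cneg c hc N hN f ϖ Lsharp Lflat hf hϖ hSP
  obtain ⟨gen, h, hchar, hι⟩ :=
    hcol (sharpFlatSelmerDualData W κ (closureEmb (K := ℚ) (v.adicCompletion ℚ))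
      (W.frobeniusTrace 3) g c col hγ)
  -- at `L(E,1) ≠ 0` both colours are non-zero (Prop. 6.14), so Thm. 7.14 gives cotorsion of `X^col`
  have hL0 : chromaticL col Lsharp Lflat ≠ 0 := by
    obtain ⟨h1, h2⟩ :=
      sharp_ne_zero_and_flat_ne_zero_of_entireLFunction_one_ne_zero hp2 hf hgood hdvd hSP hL
    cases col with
    | sharp => rwa [chromaticL_sharp]
    | flat => rwa [chromaticL_flat]
  obtain ⟨hfinD, htorD⟩ := h714 W 3 hp2 hgood hdvd f hf κ γ hκ hγ hγ' v hv g hg cneg c hc col Lsharp Lflat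
    hSP hL0
    (sharpFlatSelmerDualData W κ (closureEmb (K := ℚ) (v.adicCompletion ℚ)) (W.frobeniusTrace 3) g c
      col hγ)
  haveI := hfinD
  obtain ⟨u, hu⟩ := hK W 3 hp2 hsst hgood hdvd hL κ γ hκ hγ hγ' v hv g hg cneg c hc col _ htorD gen
    hchar hfin
  exact ⟨col, gen, fun _ => ⟨u, hu⟩, h, hι⟩

/-- **The registered stub (B) VERBATIM on X8 ∩ {`N` square-free} ∩ {`r_an = 0`}, with cotorsion from
its PRIMARY source (Sprung 2012 Thm. 1.2/7.14, `h714`) and the local lift PROVED** — inputs: named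
facts `h22` · `h714` · `hK` · modularity `hmod`, and the OPEN (MC↓•) `hdiv` only. The rank-`0`
residue of X8 ∩ {square-free} for crux 5's clause (B) thus reads «Sprung 2012 Main Conj. 7.21's
Eisenstein half for one colour on the REAL `X^•(E/ℚ_∞)`» modulo Sprung 2012 Thm. 2.2, Thm. 1.2 and
Sprung 2024 Lemmas 5.5–5.9 BY NAME. CONDITIONAL; closes nothing; 0 cells move.
[cite: Sprung2012, Thm. 1.2 (p. 1486), Prop. 6.14 (p. 1498), Main Conj. 7.21]
[cite: Sprung2024, §5.2 Lemmas 5.5–5.9 (via `hK`)] -/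
theorem stub_chromaticDivisibility_semistable_rankZero_of_sharpFlatLowerDivisibility_of_thm714
    (h22 : Sprung2012.thm22_exists_isHondaSystem)
    (h714 : Sprung2012.thm714_sharpFlatSelmerDual_finite_torsion)
    (hK : Sprung2024.lem59_sharpFlatCharValue_rankZero) (hmod : hasEntireLFunction_rat)
    (hdiv : ∀ (W : WeierstrassCurve ℚ) [W.IsElliptic] [W.IsGloballyMinimal] (p : ℕ) [Fact p.Prime],
      ClassX8 W p → ∀ (κ : ZpExtension ℚ p) (γ : Field.absoluteGaloisGroup ℚ),
        κ.IsCyclotomic → κ.IsTopGenerator γ → IsCyclotomicVariable p γ →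
      ∀ (v : HeightOneSpectrum (𝓞 ℚ)), (p : 𝓞 ℚ) ∈ v.asIdeal →
      ∀ (g : Field.absoluteGaloisGroup (v.adicCompletion ℚ)),
        κ.IsTopGenerator (resGalOfEmb (closureEmb (K := ℚ) (v.adicCompletion ℚ)) g) →
      ∀ (cneg : localPoints W (v.adicCompletion ℚ)) (c : ℕ → localPoints W (v.adicCompletion ℚ)),
        IsHondaSystem κ (closureEmb (K := ℚ) (v.adicCompletion ℚ)) W (W.frobeniusTrace p) g cneg c →
      ∀ (N : ℕ) (_ : NeZero N) (f : CuspForm (Gamma0 N) 2) (ϖ : ℚ) (Lsharp Lflat : IwasawaAlgebra p),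
        IsNewformOf W f → (ϖ : ℝ) * W.realPeriodRat = plusPeriod f →
        IsSprungPair f p (W.frobeniusTrace p) Lsharp Lflat →
        ∃ col : Chroma,
          ∀ D : SharpFlatSelmerDualData W κ γ (closureEmb (K := ℚ) (v.adicCompletion ℚ))
            (W.frobeniusTrace p) g c col,
          ∃ gen h : IwasawaAlgebra p, D.charIdeal = Ideal.span {gen} ∧
            iwasawaToPowerSeries p gen =
              PowerSeries.C (ϖ : ℚ_[p]) * iwasawaToPowerSeries p (chromaticL col Lsharp Lflat * h)) :
    ∀ (W : WeierstrassCurve ℚ) [W.IsElliptic] [W.IsGloballyMinimal] (p : ℕ) [Fact p.Prime],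
      Literature.NumberTheory.EllipticCurves.Rank1Residual.ClassX8 W p → W.IsSemistable (𝓞 ℚ) →
      W.analyticRank = 0 →
      ∀ (N : ℕ) (_ : NeZero N) (f : CuspForm (CongruenceSubgroup.Gamma0 N) 2) (ϖ : ℚ)
        (Lsharp Lflat : Literature.NumberTheory.EllipticCurves.IwasawaAlgebra p),
        Literature.NumberTheory.EllipticCurves.ModularForms.IsNewformOf W f →
        (ϖ : ℝ) * W.realPeriodRat = Literature.NumberTheory.EllipticCurves.ModularForms.plusPeriod f →
        Literature.NumberTheory.EllipticCurves.Sprung2017.IsSprungPair f p (W.frobeniusTrace p)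
          Lsharp Lflat →
        ∃ (c : Literature.NumberTheory.EllipticCurves.Sprung2017.Chroma)
          (ξ : Literature.NumberTheory.EllipticCurves.IwasawaAlgebra p),
          (⟨ξ, 0, 0⟩ : Summit.BirchSwinnertonDyer.Rank1Residual.Supersingular.SignedDatum W p).EulerCharacteristic ∧
          ∃ h : Literature.NumberTheory.EllipticCurves.IwasawaAlgebra p,
            Literature.NumberTheory.EllipticCurves.iwasawaToPowerSeries p ξ =
              PowerSeries.C (ϖ : ℚ_[p]) *
                Literature.NumberTheory.EllipticCurves.iwasawaToPowerSeries p
                  (Literature.NumberTheory.EllipticCurves.Sprung2017.chromaticL c Lsharp Lflat * h) := by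
  intro W _ _ p _ hX hsst hr N hN f ϖ Lsharp Lflat hf hϖ hSP
  have hL : W.entireLFunction 1 ≠ 0 := (W.analyticRank_eq_zero_iff_holds (hmod W)).1 hr
  exact chromaticDivisibility_of_sharpFlatLowerDivisibility_of_thm714 h22 h714 hK hdiv W p hX hsst
    (fun _ => hL) N hN f ϖ Lsharp Lflat hf hϖ hSP

end Primary

end Summit.BirchSwinnertonDyer.BirchSwinnertonDyer.Theorems

end
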